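import Mathlib
import HarnessLib
import Summits.Ventures.LatticeQCDFlow.Exactness.U1MultiStepLeapfrogHMCErgodic
import Summits.Ventures.LatticeQCDFlow.Exactness.SUNJitteredHMCFiguresOfMerit

/-!
# The `u1_2d` engine's multi-step leapfrog HMC: ONE Doeblin constant — hence ONE `τ_int` constant and ONE burn-in constant — for EVERY step size in an interval `[ε₁, ε₂]`

HONEST FRAMING: exact (Metropolis-corrected) sampling algorithms for lattice gauge theory;
figures of merit are autocorrelation/cost numbers at stated couplings and volumes; no
continuum-physics claim.

Venture `LatticeQCDFlow` (cell pub-lqcd), topic `Exactness`, FANOUT row 9 (eng-latcore, GEN-24; the engine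
`latflow.core.u1_2d.U1Field2D.hmc_trajectory(β, rng, τ, nstep)`, `nstep` P-first leapfrog steps of size `ε = τ/nstep`).
NEW WORK of the cell over gen-17's `U1MultiStepLeapfrogHMC.lean` / `U1MultiStepLeapfrogHMCErgodic.lean` (the one-step
Doeblin minorant `u1LeapfrogHMCN_minorised` — PER step size, constant existential — and its ingredients
`shortTrajRadius`, `smul_pi_haar_le_map_fst_u1LeapfrogProposalN`, `u1LeapfrogN_energy_window`,
`smul_restrict_u1MomBox_le_u1MomentumLaw`, `refreshUpdate_involMH_minorised`; the Wilson dictionary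
`u1GibbsLaw_eq_wilsonMeasure`, `u1LeapfrogHMCN_invariant_gibbsLaw`, `exists_bound_smul_wilsonAction_circle`), GEN-23's
`SUNJitteredHMCFiguresOfMerit.lean` (`doeblinConst_nonneg`) and row 13's `NCMCGeneralSpaceDoeblinPower.lean`
(`tauInt_setACF_le_of_nHit`, `chain_timeAverage_bias_le_of_nHit`, `minorised_setwise`, `nHit_one`).  Nothing is cited as
a fact; no number is claimed.

THE OBSERVATION.  Gen-17's constant is explicit inside its proof: `δ(ε) = e^{−B(R_ε)} · Z⁻¹e^{−κ|ι|R_ε²} · (3/(4nε))^{|ι|}(2π)^{|ι|}`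
with `R_ε = 3(π + εbn²)/(2nε)` DECREASING in `ε` and `B` increasing in `R`; so on `[ε₁, ε₂]` every factor is bounded
below by its value at an endpoint and ONE `δ > 0` serves every step size — the `U(1)` counterpart of GEN-24's
`SUNLeapfrogHMCUniformMinorant.lean`, with the simplification that the `U(1)` minorant is by FULL product Haar in ONE
step, so no box / spreading argument is needed.

## Content (momenta Gaussian with `κ > 0`; a FAMILY of increments `g_ε`, `ε ∈ [ε₁, ε₂]`, `0 < ε₁ ≤ ε₂`, each
measurable, `K`-Lipschitz and bounded by `b` uniformly, `4Kε₂n² ≤ 3`; action measurable, bounded by `s`)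

* §1 **`u1LeapfrogHMCN_minorised_uniform`** — ONE `δ > 0` with `δ • Haar^{⊗ι} ≤ K_{n,ε}(U, ·)` for EVERY `ε ∈ [ε₁, ε₂]`,
  every `U`.
* §2 (torus `(ℤ/L)^d`, continuous representation `ρ` of `U(1)`, any real `β`, the Wilson action `β S_W`)
  **`wilson_u1LeapfrogHMCN_certificate_uniform`** — exact for every `ε`, and ONE `0 < ε' ≤ 1` with
  `ε' • Haar^{⊗E} ≤ K_{n,ε}(U, ·)` for every `ε ∈ [ε₁, ε₂]`, every `U`;
  **`wilson_u1LeapfrogHMCN_tauInt_setACF_le_uniform`** — ONE `B ≥ 0`: `τ_int(1_A) ≤ 1/2 + B/(1 − π(A))` for EVERY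
  `ε ∈ [ε₁, ε₂]` and every event `A` (`0 < π(A) < 1`, `π = wilsonMeasure ρ β`);
  **`wilson_u1LeapfrogHMCN_timeAverage_bias_le_uniform`** — ONE burn-in constant for the whole interval.

NOT CLAIMED: any value; anything when `4Kε₂n² > 3`; uniformity in `nstep`, `κ` or `β`; that the engine's exact force
meets a given `K` (gen-17's `U1EngineForceLipschitz` statement is separate); floating point.
-/

noncomputable section

namespace Summit.Ventures.LatticeQCDFlow.Exactness

open MeasureTheory ProbabilityTheory ProbabilityTheory.Kernel Set Metric Function Filter Topology
open Literature.MathematicalPhysics.QuantumFieldTheory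
open scoped ENNReal NNReal

variable {ι : Type*}

/-! ## §1 ONE Doeblin constant for every step size in `[ε₁, ε₂]` -/

section Doeblin

variable [Fintype ι] {ε₁ ε₂ κ : ℝ} {g : ℝ → (ι → Circle) → ι → ℝ} {b : ℝ} {n : ℕ} {K : ℝ≥0}

omit [Fintype ι] in
/-- The short-trajectory momentum radius `R_ε = 3(π + εbn²)/(2nε)` is antitone in the step on `(0, ∞)`. -/
theorem shortTrajRadius_antitone {ε ε' b : ℝ} {n : ℕ} (hn : 1 ≤ n) (hε : 0 < ε) (h : ε ≤ ε') :
    shortTrajRadius ε' b n ≤ shortTrajRadius ε b n := by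
  have hn' : (0 : ℝ) < n := by exact_mod_cast hn
  have hε' : 0 < ε' := hε.trans_le h
  unfold shortTrajRadius
  rw [div_le_div_iff₀ (by positivity) (by positivity)]
  have h1 : Real.pi * ε ≤ Real.pi * ε' := mul_le_mul_of_nonneg_left h Real.pi_pos.le
  nlinarith [sq_nonneg (n : ℝ), hn', hε, hε']

/-- **ONE DOEBLIN CONSTANT FOR `n`-STEP LEAPFROG HMC ON `U(1)^ι` FOR EVERY STEP SIZE IN `[ε₁, ε₂]`.**  `0 < ε₁ ≤ ε₂`,
`κ > 0`, `n ≥ 1`; a family of increments `g_ε`, each measurable, `K`-Lipschitz with `4 K ε₂ n² ≤ 3` and bounded by `b ≥ 0`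
uniformly on the interval; the action measurable and bounded by `s`.  Then ONE `δ > 0` gives
`δ • Haar^{⊗ι} ≤ K_{n,ε}(U, ·)` for EVERY `ε ∈ [ε₁, ε₂]` and EVERY configuration `U`. -/
theorem u1LeapfrogHMCN_minorised_uniform (hε₁ : 0 < ε₁) (h12 : ε₁ ≤ ε₂) (hκ : 0 < κ) (hn : 1 ≤ n)
    (hg : ∀ ε, Measurable (g ε)) (hgK : ∀ ε ∈ Icc ε₁ ε₂, LipschitzWith K (g ε))
    (hshort : 4 * (K : ℝ) * ε₂ * (n : ℝ) ^ 2 ≤ 3) (hb0 : 0 ≤ b) (hb : ∀ ε ∈ Icc ε₁ ε₂, ∀ u l, ‖g ε u l‖ ≤ b)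
    {S : (ι → Circle) → ℝ} (hS : Measurable S) {s : ℝ} (hs : ∀ u, |S u| ≤ s) :
    ∃ δ : ℝ≥0∞, 0 < δ ∧ ∀ ε ∈ Icc ε₁ ε₂, ∀ u, δ • Measure.pi (fun _ : ι => haarProbability (Circle)) ≤
      u1LeapfrogHMCN ε κ (hg ε) S n u := by
  classical
  haveI : Fact (0 < κ) := ⟨hκ⟩
  -- uniform constants: the largest radius (at `ε₁`), the largest energy window, the smallest volume factor (at `ε₂`)
  set Rm : ℝ := shortTrajRadius ε₁ b n with hRm
  have hRm0 : 0 < Rm := shortTrajRadius_pos hε₁ hb0 hn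
  set cm : ℝ≥0∞ := (u1MomentumWeight (ι := ι) κ univ)⁻¹ *
    ENNReal.ofReal (Real.exp (-(κ * (Fintype.card ι * Rm ^ 2)))) with hcm
  set Bm : ℝ := 2 * s + κ * (Fintype.card ι * (Rm + 2 * ((n : ℝ) + 1) * b) ^ 2) with hBm
  set θm : ℝ≥0∞ := ENNReal.ofReal ((4 * ((n : ℝ) * ε₂) / 3)⁻¹ ^ Fintype.card ι) *
    ENNReal.ofReal (2 * Real.pi) ^ Fintype.card ι with hθm
  have hH : Measurable fun z : (ι → Circle) × (ι → ℝ) => S z.1 + u1Kinetic κ z.2 :=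
    (hS.comp measurable_fst).add ((measurable_u1Kinetic κ).comp measurable_snd)
  have hs0 : 0 ≤ s := (abs_nonneg _).trans (hs fun _ => 1)
  have hn' : (1 : ℝ) ≤ n := by exact_mod_cast hn
  have hε₂ : 0 < ε₂ := hε₁.trans_le h12
  refine ⟨ENNReal.ofReal (Real.exp (-Bm)) * (cm * θm), ?_, fun ε hε u => ?_⟩
  · refine ENNReal.mul_pos (ENNReal.ofReal_pos.2 (Real.exp_pos _)).ne'
      (mul_ne_zero (mul_ne_zero ?_ ?_) (mul_ne_zero ?_ ?_))
    · exact ENNReal.inv_ne_zero.2 (u1MomentumWeight_univ_ne_top hκ)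
    · exact (ENNReal.ofReal_pos.2 (Real.exp_pos _)).ne'
    · exact (ENNReal.ofReal_pos.2 (pow_pos (inv_pos.2 (by positivity)) _)).ne'
    · exact pow_ne_zero _ (ENNReal.ofReal_pos.2 (by positivity)).ne'
  -- gen-17's minorant at THIS `ε`, with its constant written out
  have hε0 : 0 < ε := hε₁.trans_le hε.1
  have hshortε : 4 * (K : ℝ) * ε * (n : ℝ) ^ 2 ≤ 3 :=
    (mul_le_mul_of_nonneg_right (mul_le_mul_of_nonneg_left hε.2 (by positivity)) (sq_nonneg _)).trans hshort
  set R : ℝ := shortTrajRadius ε b n with hR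
  have hR0 : 0 < R := shortTrajRadius_pos hε0 hb0 hn
  set c : ℝ≥0∞ := (u1MomentumWeight (ι := ι) κ univ)⁻¹ *
    ENNReal.ofReal (Real.exp (-(κ * (Fintype.card ι * R ^ 2)))) with hc
  set B : ℝ := 2 * s + κ * (Fintype.card ι * (R + 2 * ((n : ℝ) + 1) * b) ^ 2) with hB
  set θ : ℝ≥0∞ := ENNReal.ofReal ((4 * ((n : ℝ) * ε) / 3)⁻¹ ^ Fintype.card ι) *
    ENNReal.ofReal (2 * Real.pi) ^ Fintype.card ι with hθ
  have hB0 : 0 ≤ B := by positivity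
  have key : (ENNReal.ofReal (Real.exp (-B)) * (c * θ)) • Measure.pi (fun _ : ι => haarProbability (Circle)) ≤
      u1LeapfrogHMCN ε κ (hg ε) S n u := by
    refine refreshUpdate_involMH_minorised (measurable_u1LeapfrogProposalN ε n (hg ε)) hH (u1MomentumLaw κ)
      (ρ := c • volume.restrict (u1MomBox (ι := ι) R)) (smul_restrict_u1MomBox_le_u1MomentumLaw hκ R)
      (fun v => Measure.ae_smul_measure ((ae_restrict_iff' (measurableSet_u1MomBox R)).2
        (Filter.Eventually.of_forall fun p hp => le_involAcceptE_of_le hB0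
          (u1LeapfrogN_energy_window v hκ.le hb0 (hb ε hε) hs hR0.le n (norm_le_of_mem_u1MomBox hp)))) _)
      (fun v => ?_) u
    rw [Measure.map_smul, mul_smul]
    exact measure_smul_le_smul_of_le (smul_pi_haar_le_map_fst_u1LeapfrogProposalN hε0 hn (hgK ε hε) hshortε hb0 (hb ε hε) v) _
  -- the uniform constant is below gen-17's constant at `ε`
  have hRle : R ≤ Rm := shortTrajRadius_antitone hn hε₁ hε.1
  have hBle : B ≤ Bm := by
    have h1 : (R + 2 * ((n : ℝ) + 1) * b) ^ 2 ≤ (Rm + 2 * ((n : ℝ) + 1) * b) ^ 2 :=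
      pow_le_pow_left₀ (by positivity) (by linarith) 2
    have h2 : κ * (Fintype.card ι * (R + 2 * ((n : ℝ) + 1) * b) ^ 2) ≤ κ * (Fintype.card ι * (Rm + 2 * ((n : ℝ) + 1) * b) ^ 2) :=
      mul_le_mul_of_nonneg_left (mul_le_mul_of_nonneg_left h1 (by positivity)) hκ.le
    linarith
  have hcle : cm ≤ c := by
    refine mul_le_mul' le_rfl (ENNReal.ofReal_le_ofReal (Real.exp_le_exp.2 ?_))
    have : κ * (Fintype.card ι * R ^ 2) ≤ κ * (Fintype.card ι * Rm ^ 2) :=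
      mul_le_mul_of_nonneg_left (mul_le_mul_of_nonneg_left (pow_le_pow_left₀ hR0.le hRle 2) (by positivity)) hκ.le
    linarith
  have hθle : θm ≤ θ := by
    refine mul_le_mul' (ENNReal.ofReal_le_ofReal (pow_le_pow_left₀ (by positivity) ?_ _)) le_rfl
    exact inv_anti₀ (by positivity) (by nlinarith [hε.2, hn'])
  calc (ENNReal.ofReal (Real.exp (-Bm)) * (cm * θm)) • Measure.pi (fun _ : ι => haarProbability (Circle))
      ≤ (ENNReal.ofReal (Real.exp (-B)) * (c * θ)) • Measure.pi (fun _ : ι => haarProbability (Circle)) := by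
        refine Measure.le_iff'.2 fun A => ?_
        simp only [Measure.smul_apply, smul_eq_mul]
        exact mul_le_mul' (mul_le_mul' (ENNReal.ofReal_le_ofReal (Real.exp_le_exp.2 (by linarith)))
          (mul_le_mul' hcle hθle)) le_rfl
    _ ≤ _ := key

end Doeblin

/-! ## §2 The Wilson instance: ONE certificate, ONE `τ_int` constant, ONE burn-in constant on `[ε₁, ε₂]` -/

section Wilson

variable {d L N : ℕ} (ρ : Circle →* Matrix (Fin N) (Fin N) ℂ)

/-- **EXACT FOR EVERY STEP, AND ONE DOEBLIN CERTIFICATE FOR EVERY STEP SIZE IN `[ε₁, ε₂]`** (torus `(ℤ/L)^d`,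
continuous representation `ρ` of `U(1)`, any real `β`, the Wilson action `β S_W`, Gaussian momenta `κ > 0`, `n ≥ 1`
steps; a family of increments `g_ε` measurable, `K`-Lipschitz with `4Kε₂n² ≤ 3` and bounded by `b` uniformly): for
every `ε` the kernel leaves `wilsonMeasure ρ β` invariant, and ONE `0 < ε' ≤ 1` gives `ε' • Haar^{⊗E} ≤ K_{n,ε}(U, ·)`
for EVERY `ε ∈ [ε₁, ε₂]` and every `U`. -/
theorem wilson_u1LeapfrogHMCN_certificate_uniform [NeZero L] (hρ : Continuous ρ) (β : ℝ) {ε₁ ε₂ κ : ℝ}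
    (hε₁ : 0 < ε₁) (h12 : ε₁ ≤ ε₂) (hκ : 0 < κ) {n : ℕ} (hn : 1 ≤ n)
    {g : ℝ → GaugeConfig d L Circle → Edge d L → ℝ} (hg : ∀ ε, Measurable (g ε)) {K : ℝ≥0}
    (hgK : ∀ ε ∈ Icc ε₁ ε₂, LipschitzWith K (g ε)) (hshort : 4 * (K : ℝ) * ε₂ * (n : ℝ) ^ 2 ≤ 3)
    {b : ℝ} (hb0 : 0 ≤ b) (hb : ∀ ε ∈ Icc ε₁ ε₂, ∀ U e, ‖g ε U e‖ ≤ b) :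
    (∀ ε, Kernel.Invariant (u1LeapfrogHMCN ε κ (hg ε) (fun U : GaugeConfig d L Circle => β * wilsonAction ρ U) n)
        (wilsonMeasure (d := d) (L := L) ρ β)) ∧
      ∃ ε' : ℝ≥0∞, 0 < ε' ∧ ε' ≤ 1 ∧ ∀ ε ∈ Icc ε₁ ε₂, ∀ U : GaugeConfig d L Circle,
        ε' • Measure.pi (fun _ : Edge d L => haarProbability Circle) ≤
          nHit (u1LeapfrogHMCN ε κ (hg ε) (fun U : GaugeConfig d L Circle => β * wilsonAction ρ U) n) 1 U := by
  haveI : Fact (0 < κ) := ⟨hκ⟩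
  obtain ⟨s, hs⟩ := exists_bound_smul_wilsonAction_circle (d := d) (L := L) ρ hρ β
  have hS : Measurable fun U : GaugeConfig d L Circle => β * wilsonAction ρ U := (continuous_smul_wilsonAction ρ hρ β).measurable
  obtain ⟨δ, hδ0, hmin⟩ := u1LeapfrogHMCN_minorised_uniform hε₁ h12 hκ hn hg hgK hshort hb0 hb hS hs
  have hH : Measurable fun z : (GaugeConfig d L Circle) × (Edge d L → ℝ) => β * wilsonAction ρ z.1 + u1Kinetic κ z.2 :=
    (hS.comp measurable_fst).add ((measurable_u1Kinetic κ).comp measurable_snd)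
  haveI : Fact (Measurable fun z : (GaugeConfig d L Circle) × (Edge d L → ℝ) => β * wilsonAction ρ z.1 + u1Kinetic κ z.2) := ⟨hH⟩
  haveI : IsMarkovKernel (u1LeapfrogHMCN ε₁ κ (hg ε₁) (fun U : GaugeConfig d L Circle => β * wilsonAction ρ U) n) := by
    unfold u1LeapfrogHMCN; infer_instance
  have hδ1 : δ ≤ 1 := by
    have h := Measure.le_iff'.1 (hmin ε₁ ⟨le_rfl, h12⟩ fun _ => 1) univ
    rwa [Measure.smul_apply, smul_eq_mul, measure_univ, measure_univ, mul_one] at h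
  refine ⟨fun ε => ?_, δ, hδ0, hδ1, fun ε hε U => ?_⟩
  · rw [← u1GibbsLaw_eq_wilsonMeasure (d := d) (L := L) ρ β]
    exact u1LeapfrogHMCN_invariant_gibbsLaw hκ (hg ε) hS n
  · rw [GeneralNCMC.nHit_one]
    exact hmin ε hε U

/-- **ONE `τ_int` CONSTANT FOR EVERY STEP SIZE IN `[ε₁, ε₂]` AND EVERY EVENT**: same hypotheses; there is `B ≥ 0` — the
same for all `ε ∈ [ε₁, ε₂]` — with `τ_int(1_A) ≤ 1/2 + B/(1 − π(A))` for every measurable `A` with `0 < π(A) < 1`,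
`π = wilsonMeasure ρ β` (the certified `τ_int` bound of the `u1_2d` HMC does not degenerate as the step is tuned inside
the interval). -/
theorem wilson_u1LeapfrogHMCN_tauInt_setACF_le_uniform [NeZero L] (hρ : Continuous ρ) (β : ℝ) {ε₁ ε₂ κ : ℝ}
    (hε₁ : 0 < ε₁) (h12 : ε₁ ≤ ε₂) (hκ : 0 < κ) {n : ℕ} (hn : 1 ≤ n)
    {g : ℝ → GaugeConfig d L Circle → Edge d L → ℝ} (hg : ∀ ε, Measurable (g ε)) {K : ℝ≥0}
    (hgK : ∀ ε ∈ Icc ε₁ ε₂, LipschitzWith K (g ε)) (hshort : 4 * (K : ℝ) * ε₂ * (n : ℝ) ^ 2 ≤ 3)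
    {b : ℝ} (hb0 : 0 ≤ b) (hb : ∀ ε ∈ Icc ε₁ ε₂, ∀ U e, ‖g ε U e‖ ≤ b) :
    ∃ B : ℝ, 0 ≤ B ∧ ∀ ε ∈ Icc ε₁ ε₂, ∀ A : Set (GaugeConfig d L Circle), MeasurableSet A →
      0 < (wilsonMeasure (d := d) (L := L) ρ β).real A → (wilsonMeasure (d := d) (L := L) ρ β).real A < 1 →
      Scoring.tauInt (setACF (u1LeapfrogHMCN ε κ (hg ε) (fun U : GaugeConfig d L Circle => β * wilsonAction ρ U) n)
          (wilsonMeasure (d := d) (L := L) ρ β) A) ≤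
        1 / 2 + B / (1 - (wilsonMeasure (d := d) (L := L) ρ β).real A) := by
  obtain ⟨hinv, ε', hε0, hε1, hmin⟩ := wilson_u1LeapfrogHMCN_certificate_uniform ρ hρ β hε₁ h12 hκ hn hg hgK hshort hb0 hb
  haveI := isProbabilityMeasure_wilsonMeasure (d := d) (L := L) ρ hρ β
  haveI : Fact (0 < κ) := ⟨hκ⟩
  have hSm : Measurable fun U : GaugeConfig d L Circle => β * wilsonAction ρ U := (continuous_smul_wilsonAction ρ hρ β).measurable
  haveI : Fact (Measurable fun z : (GaugeConfig d L Circle) × (Edge d L → ℝ) => β * wilsonAction ρ z.1 + u1Kinetic κ z.2) :=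
    ⟨(hSm.comp measurable_fst).add ((measurable_u1Kinetic κ).comp measurable_snd)⟩
  haveI : ∀ ε, IsMarkovKernel (u1LeapfrogHMCN ε κ (hg ε) (fun U : GaugeConfig d L Circle => β * wilsonAction ρ U) n) :=
    fun ε => by unfold u1LeapfrogHMCN; infer_instance
  refine ⟨(1 : ℝ) / ε'.toReal - 1, by simpa using doeblinConst_nonneg (m := 1) one_pos hε0 hε1, fun ε hε A hA h0 h1 => ?_⟩
  have h := GeneralNCMC.tauInt_setACF_le_of_nHit (GeneralNCMC.minorised_setwise (hmin ε hε)) hε0 hε1 one_pos (hinv ε) hA h0 h1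
  simpa using h

/-- **ONE BURN-IN CONSTANT FOR EVERY STEP SIZE IN `[ε₁, ε₂]`**: same hypotheses; there is `B ≥ 0` with
`|E_{μ₀}[(1/m) Σ_{t<m} f(U_t)] − ∫ f dπ| ≤ B/m` for EVERY `ε ∈ [ε₁, ε₂]`, every initial law `μ₀`, every `[0,1]`-valued
measurable `f`, every `m ≥ 1`. -/
theorem wilson_u1LeapfrogHMCN_timeAverage_bias_le_uniform [NeZero L] (hρ : Continuous ρ) (β : ℝ) {ε₁ ε₂ κ : ℝ}
    (hε₁ : 0 < ε₁) (h12 : ε₁ ≤ ε₂) (hκ : 0 < κ) {n : ℕ} (hn : 1 ≤ n)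
    {g : ℝ → GaugeConfig d L Circle → Edge d L → ℝ} (hg : ∀ ε, Measurable (g ε)) {K : ℝ≥0}
    (hgK : ∀ ε ∈ Icc ε₁ ε₂, LipschitzWith K (g ε)) (hshort : 4 * (K : ℝ) * ε₂ * (n : ℝ) ^ 2 ≤ 3)
    {b : ℝ} (hb0 : 0 ≤ b) (hb : ∀ ε ∈ Icc ε₁ ε₂, ∀ U e, ‖g ε U e‖ ≤ b)
    [∀ ε, IsMarkovKernel (u1LeapfrogHMCN ε κ (hg ε) (fun U : GaugeConfig d L Circle => β * wilsonAction ρ U) n)] :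
    ∃ B : ℝ, 0 ≤ B ∧ ∀ ε ∈ Icc ε₁ ε₂, ∀ (μ₀ : Measure (GaugeConfig d L Circle)) [IsProbabilityMeasure μ₀]
      (f : GaugeConfig d L Circle → ℝ), Measurable f → (∀ U, 0 ≤ f U) → (∀ U, f U ≤ 1) → ∀ m : ℕ, m ≠ 0 →
      |∫ x, (∑ t ∈ Finset.range m, f (x t)) / m
          ∂(Kernel.trajMeasure (X := fun _ : ℕ => GaugeConfig d L Circle) μ₀
            (fun t : ℕ => (u1LeapfrogHMCN ε κ (hg ε) (fun U : GaugeConfig d L Circle => β * wilsonAction ρ U) n).comap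
              (fun h : (i : ↥(Finset.Iic t)) → GaugeConfig d L Circle => h ⟨t, Finset.mem_Iic.2 le_rfl⟩)
              (measurable_pi_apply _)))
        - ∫ U, f U ∂(wilsonMeasure (d := d) (L := L) ρ β)| ≤ B / m := by
  obtain ⟨hinv, ε', hε0, hε1, hmin⟩ := wilson_u1LeapfrogHMCN_certificate_uniform ρ hρ β hε₁ h12 hκ hn hg hgK hshort hb0 hb
  haveI := isProbabilityMeasure_wilsonMeasure (d := d) (L := L) ρ hρ β
  have he0 : 0 < ε'.toReal := ENNReal.toReal_pos hε0.ne' (ne_top_of_le_ne_top ENNReal.one_ne_top hε1)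
  refine ⟨1 / ε'.toReal, by positivity, fun ε hε μ₀ _ f hf h0 h1 m hm => ?_⟩
  calc _ ≤ ((1 : ℕ) : ℝ) / (ε'.toReal * m) :=
        GeneralNCMC.chain_timeAverage_bias_le_of_nHit (GeneralNCMC.minorised_setwise (hmin ε hε)) hε0 hε1 one_pos
          (hinv ε) μ₀ hf h0 h1 hm
    _ = 1 / ε'.toReal / m := by rw [Nat.cast_one, div_div]

end Wilson

end Summit.Ventures.LatticeQCDFlow.Exactness
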